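import Mathlib
import HarnessLib
import Summits.MatrixMultiplication.MatrixMultiplication.Theorems.OutsiderSandwichCoupling

/-!
# OutsiderSandwich — the laser-descent items over the route declarations (decomp-mm lens-4, g16)

The route file `Theses/OutsiderSandwich.lean` (rev 21) carries the g16 asides
`CouplingTangency` (28192), `CouplingMergeOptimal` (28193), `CouplingIsMM` (28194),
`SquaredLaserPacking` (28195), `SquaredLaserFloor` (28196), `SummitIffCoupling` (28201) and
`LaserDescent` (28202); their statements spell out the coupling tensor `C = C₁ ⊠ C₂ ⊠ C₃` verbatim
and are definitionally the Props of `Theorems/OutsiderSandwichCoupling.lean`.  This file records the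
definitional bridges and closes the two proved asides by name:

* `summitIffCoupling_holds : SummitIffCoupling` — the descended cut `ω = 2 ⟺ CouplingTangency ∧
  CouplingMergeOptimal` (kernel `summit_iff_coupling`, no hypothesis);
* `laserDescent_holds : LaserDescent` — `SquaredLaserFloor ⟹ (CouplingTangency ⟹ LaserTangency) ∧
  (LaserMergeOptimal ⟹ CouplingMergeOptimal)`;

and restates the node's edges over the route decls (`couplingTangency_of_couplingIsMM`,
`squaredLaserFloor_of_squaredLaserPacking`, `laserTangency_of_couplingIsMM`, `summit_of_coupling`).

References: [CoppersmithWinograd1990, §7]; [BurgisserClausenShokrollahi1997, Prop. 15.30];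
[Strassen1988, Thm. 3.8].
-/

noncomputable section

namespace Summit.MatrixMultiplication.MatrixMultiplication.Theorems.OutsiderSandwichCouplingItems

open Summit.MatrixMultiplication.MatrixMultiplication

/-! ## 1. Definitional bridges route decl ↔ kernel Prop -/

/-- Item 28192 `CouplingTangency` is definitionally the kernel's `CouplingTangency`. -/
theorem couplingTangency_iff :
    Theses.OutsiderSandwich.CouplingTangency ↔ Theorems.OutsiderSandwichCoupling.CouplingTangency :=
  Iff.rfl

/-- Item 28193 `CouplingMergeOptimal` is definitionally the kernel's `CouplingMergeOptimal`. -/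
theorem couplingMergeOptimal_iff :
    Theses.OutsiderSandwich.CouplingMergeOptimal ↔
      Theorems.OutsiderSandwichCoupling.CouplingMergeOptimal :=
  Iff.rfl

/-- Item 28194 `CouplingIsMM` is definitionally the kernel's `CouplingIsMM`. -/
theorem couplingIsMM_iff :
    Theses.OutsiderSandwich.CouplingIsMM ↔ Theorems.OutsiderSandwichCoupling.CouplingIsMM :=
  Iff.rfl

/-- Item 28195 `SquaredLaserPacking` is definitionally the kernel's `SquaredLaserPacking`. -/
theorem squaredLaserPacking_iff :
    Theses.OutsiderSandwich.SquaredLaserPacking ↔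
      Theorems.OutsiderSandwichCoupling.SquaredLaserPacking :=
  Iff.rfl

/-- Item 28196 `SquaredLaserFloor` is definitionally the kernel's `SquaredLaserFloor`. -/
theorem squaredLaserFloor_iff :
    Theses.OutsiderSandwich.SquaredLaserFloor ↔ Theorems.OutsiderSandwichCoupling.SquaredLaserFloor :=
  Iff.rfl

/-! ## 2. The two proved asides -/

/-- Item 28201: the descended cut `ω = 2 ⟺ CouplingTangency ∧ CouplingMergeOptimal`. [cite: Strassen1988, Thm. 3.8] -/
theorem summitIffCoupling_holds : Theses.OutsiderSandwich.SummitIffCoupling :=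
  Theorems.OutsiderSandwichCoupling.summit_iff_coupling

/-- Item 28202: the comparison with the cut of record modulo the squared laser floor. [cite: CoppersmithWinograd1990, §7] -/
theorem laserDescent_holds : Theses.OutsiderSandwich.LaserDescent := fun hQ =>
  ⟨Theorems.OutsiderSandwichCoupling.laserTangency_of_couplingTangency hQ,
    Theorems.OutsiderSandwichCoupling.couplingMergeOptimal_of_laserMergeOptimal hQ⟩

/-! ## 3. Edges between the items, over the route decls -/

/-- `S ⟹ CouplingTangency` (vacuously), over the route decl. -/
theorem couplingTangency_of_summit (hS : _root_.MatrixMultiplication) :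
    Theses.OutsiderSandwich.CouplingTangency :=
  Theorems.OutsiderSandwichCoupling.couplingTangency_of_summit hS

/-- `S ⟹ CouplingMergeOptimal` (via `ζ₁`), over the route decl. [cite: Strassen1988, Thm. 3.8] -/
theorem couplingMergeOptimal_of_summit (hS : _root_.MatrixMultiplication) :
    Theses.OutsiderSandwich.CouplingMergeOptimal :=
  Theorems.OutsiderSandwichCoupling.couplingMergeOptimal_of_summit hS

/-- Glue of the descended cut over the route decls: `CouplingTangency ⟹ CouplingMergeOptimal ⟹ S`. -/
theorem summit_of_coupling (hA : Theses.OutsiderSandwich.CouplingTangency)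
    (hR : Theses.OutsiderSandwich.CouplingMergeOptimal) : _root_.MatrixMultiplication :=
  Theorems.OutsiderSandwichCoupling.summit_of_coupling hA hR

/-- `CouplingIsMM ⟹ CouplingTangency` (no packing), over the route decls. -/
theorem couplingTangency_of_couplingIsMM (h : Theses.OutsiderSandwich.CouplingIsMM) :
    Theses.OutsiderSandwich.CouplingTangency :=
  Theorems.OutsiderSandwichCoupling.couplingTangency_of_couplingIsMM h

/-- `SquaredLaserPacking ⟹ SquaredLaserFloor`, over the route decls. [cite: CoppersmithWinograd1990, §7] -/
theorem squaredLaserFloor_of_squaredLaserPacking (hP : Theses.OutsiderSandwich.SquaredLaserPacking) :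
    Theses.OutsiderSandwich.SquaredLaserFloor :=
  Theorems.OutsiderSandwichCoupling.squaredLaserFloor_of_packing hP

/-- `SquaredLaserPacking ⟹ CouplingIsMM ⟹ LaserTangency` (item 32268), over the route decls. -/
theorem laserTangency_of_couplingIsMM (hP : Theses.OutsiderSandwich.SquaredLaserPacking)
    (h : Theses.OutsiderSandwich.CouplingIsMM) : Theses.OutsiderSandwich.LaserTangency :=
  Theorems.OutsiderSandwichCoupling.laserTangency_of_couplingIsMM hP h

/-- `SquaredLaserPacking ⟹ CouplingTangency ⟹ LaserTangency` (item 32268), over the route decls. -/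
theorem laserTangency_of_couplingTangency (hP : Theses.OutsiderSandwich.SquaredLaserPacking)
    (hA : Theses.OutsiderSandwich.CouplingTangency) : Theses.OutsiderSandwich.LaserTangency :=
  Theorems.OutsiderSandwichCoupling.laserTangency_of_couplingTangency
    (Theorems.OutsiderSandwichCoupling.squaredLaserFloor_of_packing hP) hA

end Summit.MatrixMultiplication.MatrixMultiplication.Theorems.OutsiderSandwichCouplingItems
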